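/-
Copyright (c) 2026 the pub-hodgecm-mathlib formalisation cell (harness21).  Prover seat hodgecm-mathlib-K2E4-p07 (g4), Track B «K2-LIT» ∕ h413
(stmt-HodgeConjecture-24833, supports-only), (SC-an) line (lead K2E3-p14 (g3)), road HC-14-ell, brick E5a «CAYLEY TOKEN ALGEBRA» (RULINGS #10 03:13:38Z;
census 03:15:37Z: (T1)–(T3) and the equivariance∕ratio halves of (T4)(T5) were ★ already — this file is the residual GLUE the E5 hand K2E5-p01 (g4) imports).  2026-09-04.
-/
import Summits.HodgeConjecture.HodgeConjecture.Theorems.K2E3CayleyScalingAlgebra       -- ★ (K2E3-p01): `cayley_conj`, `inverseWindow_cayley`, `inverseWindow_conj`; brings ★ `cayley`, ★ `isUnit_det_cayley_add_one`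
import Summits.HodgeConjecture.HodgeConjecture.Theorems.K2E3HCDGroupToLieRpow        -- ★ (ε5) p856877 (K2E3-p21): `weylRatio_rpow_neg_smul_cayley_eq`; brings ★ `weylRatio_smul`, `weylRatio_cayley_mul`, `normAbs`
import Summits.HodgeConjecture.HodgeConjecture.Theorems.K2E3CompactCartanRegularRay  -- ★ p855173 (K2E5-p12): `separable_charpoly_cayley_iff`, `separable_charpoly_smul_iff`
import HarnessLib

/-!
# (SC-an) road HC-14-ell, brick E5a — CAYLEY TOKEN ALGEBRA: centralisers and the `|D|^{1∕2}`-token through the central Cayley chart `X ↦ ζ · c(X)`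

Cell `pub/hodgecm-mathlib`, crux H413 = `stmt-HodgeConjecture-24833`; THEOREMS ONLY (no `def`, no instance, no notation, no `sorry`, default heartbeats); lane
`--supports stmt-HodgeConjecture-24833 --as helper`; namespace `Summit.HodgeConjecture.HodgeConjecture.Cruxes.H413.K2E3CayleyTokenAlgebra`.

CONTEXT.  Road HC-14-ell pays Harish-Chandra's Theorem 14 for the compact Cartan subgroups of `U = U(σ, Φ₃)(K)` (residual leaf `sig_K2E3HC14EllRankOne`, K2E3-p14 (g3) cand
03:09:26Z) from its Lie-algebra twin (HC13-Lie-ell) along CENTRAL CAYLEY CHARTS `γ = ζ · c(X)`, `c(X) = (1 + X)(1 − X)⁻¹` (★ `UnitaryFinTopForm.cayley`), `ζ` a central unitary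
scalar (E5, K2E5-p01 (g4)).  The E5 hand needs, besides what is ★ — (T1) ★ `K2E3CayleyCharpolyDiscr.discr_charpoly_cayley_mul_det_pow` (`disc χ_{c X}·det(1−X)^{2(N−1)} =
2^{N(N−1)}·disc χ_X`, any ring∕rank), (T2) ★ `det_cayley_mul_det`, (T3) ★ `separable_charpoly_cayley_iff` ∕ `separable_charpoly_smul_iff`, (T4) Ad-equivariance ★ `cayley_conj`,
(T5) the ratio identity ★ `weylRatio_cayley_mul` ∕ ★ `weylRatio_smul` ∕ ★ (ε5) `weylRatio_rpow_neg_smul_cayley_eq` — exactly the following glue, typed here: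

* §1 (any commutative ring `R`, any index type, `2 ∈ Rˣ`, `det(1 − X) ∈ Rˣ`) **`conj_cayley_eq_iff`**: `x·c(X)·x⁻¹ = c(X) ↔ x·X·x⁻¹ = X` (⇐ ★ `cayley_conj`; ⇒ the inverse window
  ★ `inverseWindow_conj` ∕ ★ `inverseWindow_cayley`); **`conj_smul_cayley_eq_iff`**: the same for `ζ • c(X)`, `ζ ∈ Rˣ`; **`units_conj_eq_iff_of_val_eq_smul_cayley`**: the `GL`-level
  form `x * g * x⁻¹ = g ↔ x·X·x⁻¹ = X` for `↑g = ζ • c(X)` — so `Z(ζ c(X)) = Z(X)` for every subgroup acting through `GL`.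
* §2 (`3 × 3`) **`isRegularElt_iff_of_val_eq_smul_cayley`**: `IsRegularElt g ↔ X.charpoly.Separable` for `↑g = ζ • c(X)` (regular ↔ `disc ≠ 0` side of the chart).
* §3 (`K` a non-archimedean local field, `2 ≠ 0`, `ζ ≠ 0`, `det(1 ± X) ≠ 0`) the TOKEN COMPARISON in the two frozen spellings of the line: the GROUP token of the residual leaf
  `√√(|disc χ_γ|·|det γ|⁻²)` (★ (M5e-1)) at `γ = ζ • c(X)` versus the LIE token `|disc χ_X|^{1∕4}` of (HC13-Lie-ell):
  **`coe_sqrt_sqrt_weylRatio_smul_cayley`**: `↑(√√(|disc χ_{ζ c X}|·|det(ζ c X)|⁻²)) = (↑(|2|⁶ ∕ |det(1−X)·det(1+X)|²))^{1∕4} · (↑|disc χ_X|)^{1∕4}` in `ℝ≥0∞` — the two-sided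
  constant is `|2|^{3∕2}·|det(1−X)|^{−1∕2}·|det(1+X)|^{−1∕2}` (symmetric); on `U`, where `|det γ| = 1` and `|ζ| = 1`, **`normAbs_det_one_add_eq_of_normAbs_det_smul_cayley`** gives
  `|det(1+X)| = |det(1−X)|`, i.e. the constant is `|2|^{3∕2}·|det(1−X)|⁻¹` as in RULINGS #8 (R8-2)(iii); plus the exponent-free `ℝ≥0` form **`weylRatio_smul_cayley_mul_sq`**.
[cite: HarishChandra1970, Part VI §8 Theorem 14 p. 60; Part VII §3 Theorem 19 p. 70] [cite: HarishChandra1999AdmissibleDistributions, §17] [cite: PlatonovRapinchuk1994, §3.3]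
[cite: Rogawski1990, §4.9 p. 54, §7.3 p. 97]
HONEST LABEL: HC_CM is proved only modulo the 7 printed citations (2 remaining named inputs: hLiu418 = stmt-HodgeConjecture-24832, h413 = stmt-HodgeConjecture-24833) until rung 0
closes; pure algebra ∕ valuation bookkeeping, count-neutral; (SC-an) is NOT proved here.

## References
* [HarishChandra1970] Harish-Chandra (notes by G. van Dijk), *Harmonic Analysis on Reductive p-adic Groups*, LNM 162 (1970), Part VI §8 Thm 14; Part VII §3 Thm 19.
* [HarishChandra1999AdmissibleDistributions] Harish-Chandra (DeBacker–Sally), *Admissible Invariant Distributions on Reductive p-adic Groups* (1999), §17.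
* [PlatonovRapinchuk1994] V. Platonov, A. Rapinchuk, *Algebraic Groups and Number Theory* (1994), §3.3 (Cayley parametrisation).
* [Rogawski1990] J. D. Rogawski, *Automorphic Representations of Unitary Groups in Three Variables*, Ann. of Math. Stud. 123 (1990), §4.9 p. 54; §7.3 p. 97.
-/

set_option autoImplicit false
set_option linter.dupNamespace false

noncomputable section

open Polynomial
open Literature.NumberTheory.Automorphic Literature.NumberTheory.Rogawski1990 Literature.NumberTheory.Weil1982.UnitaryFinTopForm Literature.LinearAlgebra.Matrix
open Literature.NumberTheory.GaloisRepresentations.IsNonarchimedeanLocalField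
open Summit.HodgeConjecture.HodgeConjecture.Cruxes.H413.K2E3CayleyScalingAlgebra
open Summit.HodgeConjecture.HodgeConjecture.Cruxes.H413.F0P3cStCharTSHCDGroupToLie
open Summit.HodgeConjecture.HodgeConjecture.Cruxes.H413.K2E3HCDGroupToLieRpow
open Summit.HodgeConjecture.HodgeConjecture.Cruxes.H413.K2E3CompactCartanRegularRay
open scoped Matrix MatrixGroups NNReal ENNReal

namespace Summit.HodgeConjecture.HodgeConjecture.Cruxes.H413.K2E3CayleyTokenAlgebra

/-! ## §1 Centralisers through the central Cayley chart (any commutative ring, any rank) -/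

section Ring

variable {R : Type*} [CommRing R] {n : Type*} [Fintype n] [DecidableEq n]

/-- **(T4) `x` centralises `c(X)` iff it centralises `X`** (`2, det(1 − X) ∈ Rˣ`): ⇐ by Ad-equivariance ★ `cayley_conj`; ⇒ by applying the (equivariant) inverse window
`M ↦ (M − 1)(M + 1)⁻¹`, which recovers `X` from `c(X)` (★ `inverseWindow_conj`, ★ `inverseWindow_cayley`). [cite: PlatonovRapinchuk1994, §3.3] -/
theorem conj_cayley_eq_iff (h2 : IsUnit (2 : R)) {X : Matrix n n R} (hm : IsUnit (1 - X).det) (x : GL n R) :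
    (x : Matrix n n R) * cayley X * ((x⁻¹ : GL n R) : Matrix n n R) = cayley X ↔
      (x : Matrix n n R) * X * ((x⁻¹ : GL n R) : Matrix n n R) = X := by
  constructor
  · intro h
    have hw := inverseWindow_conj x (isUnit_det_cayley_add_one h2 hm)
    rw [h, inverseWindow_cayley h2 hm] at hw
    exact hw.symm
  · intro h
    rw [← cayley_conj x hm, h]

/-- **(T4) with the central factor**: `x·(ζ c(X))·x⁻¹ = ζ c(X) ↔ x·X·x⁻¹ = X` for `ζ ∈ Rˣ`. [cite: PlatonovRapinchuk1994, §3.3] -/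
theorem conj_smul_cayley_eq_iff (h2 : IsUnit (2 : R)) {X : Matrix n n R} (hm : IsUnit (1 - X).det) {z : R} (hz : IsUnit z) (x : GL n R) :
    (x : Matrix n n R) * (z • cayley X) * ((x⁻¹ : GL n R) : Matrix n n R) = z • cayley X ↔
      (x : Matrix n n R) * X * ((x⁻¹ : GL n R) : Matrix n n R) = X := by
  rw [Matrix.mul_smul, Matrix.smul_mul, hz.smul_left_cancel, conj_cayley_eq_iff h2 hm]

/-- **(T4) at the `GL` level**: for `g ∈ GL_n(R)` with `↑g = ζ • c(X)`, `x g x⁻¹ = g ↔ x·X·x⁻¹ = X` — so for any group acting through `GL_n(R)` the centraliser of the chart point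
`ζ c(X)` is the centraliser of `X`. [cite: PlatonovRapinchuk1994, §3.3] -/
theorem units_conj_eq_iff_of_val_eq_smul_cayley (h2 : IsUnit (2 : R)) {X : Matrix n n R} (hm : IsUnit (1 - X).det) {z : R} (hz : IsUnit z)
    {g : GL n R} (hg : (g : Matrix n n R) = z • cayley X) (x : GL n R) :
    x * g * x⁻¹ = g ↔ (x : Matrix n n R) * X * ((x⁻¹ : GL n R) : Matrix n n R) = X := by
  rw [← conj_smul_cayley_eq_iff h2 hm hz x, ← hg, ← Units.val_mul, ← Units.val_mul]
  exact Units.ext_iff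

end Ring

/-! ## §2 Regularity through the chart (`3 × 3`) -/

section Regular

variable {R : Type*} [CommRing R]

/-- **Regular ↔ `disc χ_X ≠ 0` side**: for `g ∈ GL₃(R)` with `↑g = ζ • c(X)` (`2, ζ, det(1 − X) ∈ Rˣ`), `IsRegularElt g ↔ X.charpoly.Separable`
(★ `separable_charpoly_smul_iff`, ★ `separable_charpoly_cayley_iff`). [cite: Rogawski1990, §3.1 p. 19] [cite: PlatonovRapinchuk1994, §3.3] -/
theorem isRegularElt_iff_of_val_eq_smul_cayley (h2 : IsUnit (2 : R)) {X : Matrix (Fin 3) (Fin 3) R} (hm : IsUnit (1 - X).det) {z : R} (hz : IsUnit z)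
    {g : GL (Fin 3) R} (hg : (g : Matrix (Fin 3) (Fin 3) R) = z • cayley X) :
    IsRegularElt g ↔ X.charpoly.Separable := by
  rw [isRegularElt_iff, hg, separable_charpoly_smul_iff hz, separable_charpoly_cayley_iff h2 hm]

end Regular

/-! ## §3 The token comparison over a non-archimedean local field -/

section Token

variable {K : Type*} [Field K] [ValuativeRel K] [TopologicalSpace K] [IsNonarchimedeanLocalField K]

/-- **Exponent-free form**: `(|disc χ_{ζ c X}|·|det(ζ c X)|⁻²) · |det(1−X)·det(1+X)|² = |2|⁶·|disc χ_X|` (★ `weylRatio_smul` then ★ `weylRatio_cayley_mul`).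
[cite: Rogawski1990, §4.9 p. 54] [cite: PlatonovRapinchuk1994, §3.3] -/
theorem weylRatio_smul_cayley_mul_sq {z : K} (hz : z ≠ 0) {X : Matrix (Fin 3) (Fin 3) K} (hm : IsUnit (1 - X).det) (hp : IsUnit (1 + X).det) :
    normAbs K (z • cayley X).charpoly.discr * ((normAbs K (z • cayley X).det) ^ 2)⁻¹ * (normAbs K ((1 - X).det * (1 + X).det)) ^ 2 =
      (normAbs K 2) ^ 6 * normAbs K X.charpoly.discr := by
  rw [weylRatio_smul hz]
  exact weylRatio_cayley_mul hm hp

/-- `↑(√√a) = (↑a)^{1∕4}` in `ℝ≥0∞` (the residual leaf's `NNReal.sqrt ∘ NNReal.sqrt` spelling versus the Lie side's `rpow (1∕4)`). [folklore] -/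
theorem coe_sqrt_sqrt_eq_rpow (a : ℝ≥0) : ((NNReal.sqrt (NNReal.sqrt a) : ℝ≥0) : ℝ≥0∞) = (a : ℝ≥0∞) ^ (1 / 4 : ℝ) := by
  rw [NNReal.sqrt_eq_rpow, NNReal.sqrt_eq_rpow, ← NNReal.rpow_mul, ← ENNReal.coe_rpow_of_nonneg _ (by norm_num)]
  norm_num

/-- **(T5) THE TOKEN COMPARISON** (`2 ≠ 0`, `ζ ≠ 0`, `det(1 ± X) ≠ 0`): the GROUP token `√√(|disc χ_γ|·|det γ|⁻²)` of the residual leaf at the chart point `γ = ζ • c(X)` is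
`(|2|⁶ ∕ |det(1−X)·det(1+X)|²)^{1∕4} · |disc χ_X|^{1∕4}` — the LIE token times a factor which is locally constant on the chart (★ (ε5) `weylRatio_rpow_neg_smul_cayley_eq` at
`r = −1∕4`, rewritten without negative exponents). [cite: HarishChandra1999AdmissibleDistributions, §17] [cite: Rogawski1990, §4.9 p. 54] [cite: PlatonovRapinchuk1994, §3.3] -/
theorem coe_sqrt_sqrt_weylRatio_smul_cayley (h2 : (2 : K) ≠ 0) {z : K} (hz : z ≠ 0) {X : Matrix (Fin 3) (Fin 3) K} (hm : IsUnit (1 - X).det)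
    (hp : IsUnit (1 + X).det) :
    ((NNReal.sqrt (NNReal.sqrt (normAbs K (z • cayley X).charpoly.discr * ((normAbs K (z • cayley X).det) ^ 2)⁻¹)) : ℝ≥0) : ℝ≥0∞) =
      ((((normAbs K 2) ^ 6 / (normAbs K ((1 - X).det * (1 + X).det)) ^ 2 : ℝ≥0) : ℝ≥0∞)) ^ (1 / 4 : ℝ) *
        ((normAbs K X.charpoly.discr : ℝ≥0∞)) ^ (1 / 4 : ℝ) := by
  have hpt : (normAbs K ((1 - X).det * (1 + X).det)) ^ 2 / (normAbs K 2) ^ 6 ≠ 0 :=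
    div_ne_zero (pow_ne_zero _ ((map_ne_zero (normAbs K)).2 (mul_ne_zero hm.ne_zero hp.ne_zero))) (pow_ne_zero _ ((map_ne_zero (normAbs K)).2 h2))
  have key := weylRatio_rpow_neg_smul_cayley_eq h2 hz hm hp (-(1 / 4 : ℝ))
  rw [neg_neg] at key
  rw [coe_sqrt_sqrt_eq_rpow, key, ENNReal.rpow_neg, ← ENNReal.inv_rpow, ← ENNReal.coe_inv hpt, inv_div]

/-- **On `U`: `|det(1 + X)| = |det(1 − X)|`** when `|det(ζ c X)| = 1` and `|ζ| = 1` (`det c(X)·det(1−X) = det(1+X)` ★ `det_cayley_mul_det`, `det(ζ • M) = ζ³ det M`), so the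
chart constant of `coe_sqrt_sqrt_weylRatio_smul_cayley` reads `|2|^{3∕2}·|det(1−X)|⁻¹` there. [cite: PlatonovRapinchuk1994, §3.3] [cite: Rogawski1990, §7.3 p. 97] -/
theorem normAbs_det_one_add_eq_of_normAbs_det_smul_cayley {z : K} (hz1 : normAbs K z = 1) {X : Matrix (Fin 3) (Fin 3) K} (hm : IsUnit (1 - X).det)
    (h1 : normAbs K (z • cayley X).det = 1) : normAbs K (1 + X).det = normAbs K (1 - X).det := by
  have hc : (cayley X).det * (1 - X).det = (1 + X).det := by
    rw [cayley_def]; exact det_cayley_mul_det X hm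
  rw [Matrix.det_smul, Fintype.card_fin, map_mul, map_pow, hz1, one_pow, one_mul] at h1
  rw [← hc, map_mul, h1, one_mul]

end Token

end Summit.HodgeConjecture.HodgeConjecture.Cruxes.H413.K2E3CayleyTokenAlgebra

end
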